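import Summits.Ventures.Crystal3D.Theorems.StickyWulffConstantCoaxialWallLawTailResidueModuleCaptureShallow
import Summits.Ventures.Crystal3D.Theorems.StickyWulffConstantCoaxialWallLawReaderTriangles
import HarnessLib

/-!
# Reading directions are EXACTLY the unit vectors of the fine lattice: every contact between two exact positions is read in `V`
# (crux `CoaxialWallLaw`, stmt-Ventures-19481; brick (L4a) of MODULE-CAPTURE-PLAN-g10 for `stub_moduleCapture`; also the missing
# «apex–apex» case of F-TAIL-g9 §7 used by cf-p2's reader evaluation at apex balls)

HONEST FRAMING. Venture `Summits/Ventures/Crystal3D` (cell `crystal3d-full`); helper `--supports` the crux `CoaxialWallLaw`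
(stmt-Ventures-19481, `route-Ventures-StickyWulffConstant`), registered line 'CoaxialWallLawCertificates' (planner cf-p1).  Census-free
(one `decide` over the `25³` fine-coordinate box, integer arithmetic only); F-C1 not moved.
THE FINE LATTICE `Λ'` = the ℤ-span of the module sites and the first-generation apex vectors, in the fine cubic coordinates of
`…ReadingDirections` (`fineVec t = t / (9√2)` in the cubic frame): it has index `18` in `ℤ³` and is cut out by the congruences
`t₀ + t₁ ≡ t₀ + t₂ ≡ 0 (mod 3)`, `t₀ + t₁ + t₂ ≡ 0 (mod 2)` (`InFineLattice`).
* `vint_of_lattice_unit` — **the unit vectors of `Λ'` are exactly the 54 reading directions `VInt`** (`decide`);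
* `inFineLattice_siteFine`, `inFineLattice_apexFine`, `inFineLattice_sub`, `inFineLattice_of_mem_apexBall` — sites, apex vectors, hence all exact
  positions (`exactPos` of …TailResidueDefsM) lie in `Λ'`, which is closed under differences;
* **`sub_mem_readingDirs_of_exactPos`** — two exact positions at distance `1` differ by a reading direction (site–site, site–apex and the new
  apex–apex case in one statement);
* **`readingDirs_of_exactOf`** — at an exact ball `q` of a window every exact contact is read in a reading direction: the hypothesis `hread` of
  `stdFrame_of_isEndMove_of_readingDirs` on the exact part, so every class firing on exact positions has a STANDARD frame (`stdFrame_of_exact_reader`).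
WHAT THIS IS NOT: not `ModuleCapture`; F-C1 not moved.
-/

noncomputable section

-- the window Finsets (`siteBall`, `apexBall`) are large closed terms; unification around them needs a deeper recursion budget
set_option maxRecDepth 65536

namespace Summit.Ventures.Crystal3D.Theorems

namespace TailResidue

open Summit.Ventures.Crystal3D Finset
open scoped InnerProductSpace

/-! ### The fine lattice and its unit vectors (integer core) -/

/-- **The fine lattice `Λ'`** (ℤ-span of module sites and apex vectors, fine cubic coordinates): index `18` in `ℤ³`. -/
def InFineLattice (t : ℤ × ℤ × ℤ) : Prop := (t.1 + t.2.1) % 3 = 0 ∧ (t.1 + t.2.2) % 3 = 0 ∧ (t.1 + t.2.1 + t.2.2) % 2 = 0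

/-- Decidability of membership in `Λ'` (three congruences). -/
instance instDecidableInFineLattice (t : ℤ × ℤ × ℤ) : Decidable (InFineLattice t) := by
  unfold InFineLattice; infer_instance

/-- The coordinate range `[-12, 12]`. -/
def fineRange : List ℤ :=
  [-12, -11, -10, -9, -8, -7, -6, -5, -4, -3, -2, -1, 0, 1, 2, 3, 4, 5, 6, 7, 8, 9, 10, 11, 12]

/-- The box `[-12, 12]³` of fine coordinates (contains every vector of fine norm `162`, i.e. every unit vector). -/
def fineBox : List (ℤ × ℤ × ℤ) :=
  fineRange.flatMap fun a => fineRange.flatMap fun b => fineRange.map fun c => (a, b, c)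

set_option maxRecDepth 100000 in
/-- **THE UNIT VECTORS OF THE FINE LATTICE ARE THE READING DIRECTIONS** (integer core, by `decide` over the box). -/
theorem vint_of_lattice_unit : ∀ t ∈ fineBox, InFineLattice t → dotI t t = 162 → t ∈ VInt := by
  decide

/-- Membership in the coordinate range from bounds. -/
theorem mem_fineRange {a : ℤ} (h1 : -12 ≤ a) (h2 : a ≤ 12) : a ∈ fineRange := by
  unfold fineRange
  interval_cases a <;> simp

/-- Membership in the box from bounds. -/
theorem mem_fineBox {t : ℤ × ℤ × ℤ} (h0 : -12 ≤ t.1 ∧ t.1 ≤ 12) (h1 : -12 ≤ t.2.1 ∧ t.2.1 ≤ 12) (h2 : -12 ≤ t.2.2 ∧ t.2.2 ≤ 12) :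
    t ∈ fineBox := by
  obtain ⟨a, b, c⟩ := t
  unfold fineBox
  simp only [List.mem_flatMap, List.mem_map]
  exact ⟨a, mem_fineRange h0.1 h0.2, b, mem_fineRange h1.1 h1.2, c, mem_fineRange h2.1 h2.2, rfl⟩

/-- A fine vector of norm `162` lies in the box. -/
theorem mem_fineBox_of_norm {t : ℤ × ℤ × ℤ} (h : dotI t t = 162) : t ∈ fineBox := by
  obtain ⟨a, b, c⟩ := t
  simp only [dotI] at h
  refine mem_fineBox ⟨?_, ?_⟩ ⟨?_, ?_⟩ ⟨?_, ?_⟩ <;> dsimp only <;> nlinarith [sq_nonneg a, sq_nonneg b, sq_nonneg c, sq_nonneg (a + 13), sq_nonneg (a - 13),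
    sq_nonneg (b + 13), sq_nonneg (b - 13), sq_nonneg (c + 13), sq_nonneg (c - 13)]

/-- **Unit vectors of `Λ'` are reading directions** (no box hypothesis). -/
theorem mem_VInt_of_lattice_unit {t : ℤ × ℤ × ℤ} (hL : InFineLattice t) (h : dotI t t = 162) : t ∈ VInt :=
  vint_of_lattice_unit t (mem_fineBox_of_norm h) hL h

/-! ### Exact positions lie in the fine lattice -/

/-- `Λ'` is closed under differences. -/
theorem inFineLattice_sub {t u : ℤ × ℤ × ℤ} (ht : InFineLattice t) (hu : InFineLattice u) :
    InFineLattice (t.1 - u.1, t.2.1 - u.2.1, t.2.2 - u.2.2) := by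
  obtain ⟨h1, h2, h3⟩ := ht
  obtain ⟨g1, g2, g3⟩ := hu
  refine ⟨?_, ?_, ?_⟩ <;> dsimp only <;> omega

/-- `Λ'` is closed under sums. -/
theorem inFineLattice_addI {t u : ℤ × ℤ × ℤ} (ht : InFineLattice t) (hu : InFineLattice u) : InFineLattice (addI t u) := by
  obtain ⟨h1, h2, h3⟩ := ht
  obtain ⟨g1, g2, g3⟩ := hu
  refine ⟨?_, ?_, ?_⟩ <;> dsimp only [addI] <;> omega

/-- Module sites lie in `Λ'`. -/
theorem inFineLattice_siteFine (s : ℤ × ℤ × ℤ) : InFineLattice (siteFine s) := by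
  refine ⟨?_, ?_, ?_⟩ <;> dsimp only [siteFine] <;> omega

/-- The first-generation apex vectors lie in `Λ'` (finite check over the menu pairs). -/
theorem inFineLattice_apexFine : ∀ p ∈ menuPairs ×ˢ (Finset.univ : Finset Bool), InFineLattice (apexFine p.1.1 p.1.2 p.2) := by
  decide

/-- Apex positions of the window lie in `Λ'`. -/
theorem inFineLattice_of_mem_apexBall {F : ℤ × ℤ × ℤ} (hF : F ∈ apexBall) : InFineLattice F := by
  classical
  unfold apexBall at hF
  rw [Finset.mem_filter] at hF
  obtain ⟨hF, -⟩ := hF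
  rw [Finset.mem_image] at hF
  obtain ⟨p, hp, rfl⟩ := hF
  rw [Finset.mem_product] at hp
  obtain ⟨-, hs⟩ := hp
  have hs' : p.2.1 ∈ menuPairs := by
    unfold apexSides at hs
    exact (Finset.mem_product.1 (Finset.mem_filter.1 hs).1).1
  exact inFineLattice_addI (inFineLattice_siteFine _) (inFineLattice_apexFine (p.2.1, p.2.2) (Finset.mem_product.2 ⟨hs', Finset.mem_univ _⟩))

/-- Every exact position is `fineVec` of a vector of `Λ'`. -/
theorem exists_fine_of_exactPos {x : EuclideanSpace ℝ (Fin 3)} (hx : x ∈ exactPos) : ∃ t, InFineLattice t ∧ fineVec t = x := by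
  rcases hx with ⟨s, -, rfl⟩ | ⟨F, hF, rfl⟩
  · exact ⟨siteFine s, inFineLattice_siteFine s, (modSite_eq_fineVec s).symm⟩
  · exact ⟨F, inFineLattice_of_mem_apexBall (Finset.mem_coe.1 hF), rfl⟩

/-! ### Contacts between exact positions are read in reading directions -/

/-- **Two points of `Λ'` at distance `1` differ by a reading direction.** -/
theorem fineVec_sub_mem_readingDirs {t u : ℤ × ℤ × ℤ} (ht : InFineLattice t) (hu : InFineLattice u) (h : dist (fineVec t) (fineVec u) = 1) :
    fineVec t - fineVec u ∈ readingDirs := by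
  rw [fineVec_sub]
  refine ⟨_, mem_VInt_of_lattice_unit (inFineLattice_sub ht hu) ?_, rfl⟩
  have h1 : ‖fineVec (t.1 - u.1, t.2.1 - u.2.1, t.2.2 - u.2.2)‖ = 1 := by rw [← fineVec_sub, ← dist_eq_norm, h]
  have h2 := norm_fineVec_sq (t.1 - u.1, t.2.1 - u.2.1, t.2.2 - u.2.2)
  rw [h1, one_pow] at h2
  have h3 : (dotI (t.1 - u.1, t.2.1 - u.2.1, t.2.2 - u.2.2) (t.1 - u.1, t.2.1 - u.2.1, t.2.2 - u.2.2) : ℝ) = 162 := by linarith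
  exact_mod_cast h3

/-- **Two EXACT POSITIONS at distance `1` differ by a reading direction** (site–site, site–apex, apex–apex uniformly). -/
theorem sub_mem_readingDirs_of_exactPos {x y : EuclideanSpace ℝ (Fin 3)} (hx : x ∈ exactPos) (hy : y ∈ exactPos) (h : dist x y = 1) :
    x - y ∈ readingDirs := by
  obtain ⟨t, ht, rfl⟩ := exists_fine_of_exactPos hx
  obtain ⟨u, hu, rfl⟩ := exists_fine_of_exactPos hy
  exact fineVec_sub_mem_readingDirs ht hu h

/-- **At an exact ball of a window every exact contact is read in a reading direction** — the hypothesis `hread` of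
`stdFrame_of_isEndMove_of_readingDirs` on the exact part `exactOf Y`. -/
theorem readingDirs_of_exactOf {Y : Finset (EuclideanSpace ℝ (Fin 3))} {q : EuclideanSpace ℝ (Fin 3)} (hq : q ∈ exactPos) :
    ∀ x ∈ exactOf Y, dist x q = 1 → x - q ∈ readingDirs := by
  classical
  intro x hx hd
  exact sub_mem_readingDirs_of_exactPos (mem_exactOf_iff.1 hx).2 hq hd

/-- **Every class that fires on exact positions has a standard frame**: if `q` is at an exact position and end-moves onto `b` in the exact part
`exactOf Y` in the class frame `G`, then `StdFrame G`. -/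
theorem stdFrame_of_exact_reader {Y : Finset (EuclideanSpace ℝ (Fin 3))} {v : WordVersion}
    {G : EuclideanSpace ℝ (Fin 3) ≃ₗᵢ[ℝ] EuclideanSpace ℝ (Fin 3)} {d q b : EuclideanSpace ℝ (Fin 3)} (hq : q ∈ exactPos)
    (h : IsEndMove (exactOf Y) v G d q b) : StdFrame G :=
  stdFrame_of_isEndMove_of_readingDirs h (readingDirs_of_exactOf hq)

end TailResidue

end Summit.Ventures.Crystal3D.Theorems

end
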